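import Summits.RiemannHypothesis.RiemannHypothesis.Theorems.PfPersistenceNearLagLadder
import Summits.RiemannHypothesis.RiemannHypothesis.Theorems.PfPersistenceGapClassG1
import HarnessLib

/-!
# PF-persistence cell — DIAL-LINE RIGIDITY: vanishing certificates pin the `p`-dial line to `K = 1`

Framing (page 1): mechanism/rigidity campaign; no RH claims.  Every `theorem` below is PROVED (kernel-checked,
RH-free, weight-free: any `Weights`, any family of windows); nothing asserts a premiss for `ζ` at any window, and
every NUMBER quoted for `ζ` is DATA with its provenance.

THE STATEMENT TYPED.  Fix a prime power `p`, weights `w` with `0 ≤ w p`, a floor `φ ≥ 0` and a family `𝒲` of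
windows.  An EVEN CERTIFICATE of width `δ` at `win ∈ 𝒲` (`p` reached) is a test vector `v ≠ 0` of the even block
with level bound `ℓ`, anti-correlation `A_v(log p) ≤ -σ‖v‖²` and `ℓ − ε₁⁺(w;win) < 2δ·w_p·(σ − 2φ(2N+1))`; an ODD
CERTIFICATE of width `δ` is a one-signed-odd autocorrelation CEILING `c` at lag `log p` (any of the tree's:
far range `2φN`, golden `(1+√5)/4 + 2φN`, the rung-free ladder `cos(π/(⌈a/log p⌉₊+1)) + 2φN`) together with an odd
test vector `v' ≠ 0`, level bound `ℓ'`, correlation floor `τ‖v'‖² ≤ A⁻_{v'}(log p)` and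
`ℓ' − ε₁⁻(w;win) < 2δ·w_p·(τ − c)`.  PROVED here:
* §1 ESCAPE AT FINITE HEIGHT: an even certificate of width `δ` at `win` rejects EVERY down-dial `K ≤ 1 − δ` from the
  `φ`-floor-nodeless reader at `win`; an odd one rejects every up-dial `K ≥ 1 + δ` (the served laws
  `dial_not_mem_floorNodelessEOAt_of_threshold`, `upDial_not_mem_floorNodelessOddAt_of_ceiling`, monotone in `K`).
* §2 RIGIDITY: if `𝒲` carries even certificates of arbitrarily small width then every `K` whose dialled datum is
  `φ`-floor-nodeless at every window of `𝒲` has `1 ≤ K`; odd certificates of arbitrarily small width give `K ≤ 1`;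
  both give `K = 1` — the dial line meets the all-`𝒲` class in at most the point `ζ` itself
  (`dialLine_subset_singleton_of_certificates`; `ζ`/`pDial` handle in the `GapClassG1` vocabulary, §3).
* §3 the all-window class `⋂ win, floorNodelessEOAt φ win` and the `pDial` line of clause (3) of G1: rigidity is a
  statement about MEMBERSHIP of the dialled data, not about `StableAlong` (W4 concerns agreement with SOME member per
  window and is untouched); contrast: the coupling tube (`PfPersistenceCouplingTubeStrict`) is a G1 class excluding every
  dial `K ≠ 1` by construction — here the class is the NATURAL floor-nodeless reader and the exclusion is CONDITIONAL.
* §4 the RUNG-FREE instance: the odd ceiling is the complete ladder's `cos(π/(⌈a/log p⌉₊+1)) + 2φN`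
  (`PfPersistenceNearLagLadder`, 186f1e2d346c), so an odd certificate is a bare triple `(v', ℓ', τ)`; `ζ` handle.
WHAT IS NOT PROVED, AND THE DATA (RULINGS A15/A22/A311 framing).  Whether `ζ`'s certificates vanish along ANY
family is OPEN and is exactly of all-window-positivity strength (it needs control of `ε₁^±(ζ; a, N)` as `a → ∞`).
DATA of record (cand-6 gens 8–9, files `out/g8_autocorr_gap_mp130_j069471.json`, `out/g8_autocorr_gap_mp260_j070483.json`,
`out/g9_nearlag_N40_j072465.json`; mpmath 130/260 digits, S1 interval Galerkin): at FIXED dilation `a` the served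
certificate widths do NOT tend to `0` as `N → ∞` — the two-sided rejected radius `|1−K|` stabilises at a positive
value (`1.9e-7` at `(a,N) = (log 2, 40)`, `1.46e-88` at `(1.5, 200)`, `5.61e-213` at `(1.96, 200)`, `8.39e-207` at
`(2.3, 120)`; family = served even/odd bottom vectors, margins as filed) — so the hypotheses of §2 are DATA-FALSE
for `ζ` along every fixed-`a` family and rigidity, if it holds for `ζ`, lives along `a → ∞` at the fixed prime,
where `p` slides down the near-lag ladder (`m = ⌈a/log p⌉₊ → ∞`, ceiling `cos(π/(m+1)) → 1`): the regime the
complete ladder (`PfPersistenceNearLagLadder`) types.  No sentence here is a statement about RH.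
-/

set_option linter.dupNamespace false
set_option linter.style.longLine false

open Real Finset Matrix Set

noncomputable section

namespace Summit.RiemannHypothesis.RiemannHypothesis.Theorems.PfPersistence

/-! ## §1 Escape at finite height: a certificate of width `δ` rejects every dial beyond `δ` -/

/-- **PROVED — EVEN CERTIFICATE ⇒ EVERY DOWN-DIAL BEYOND ITS WIDTH ESCAPES AT THIS WINDOW.** An even certificate of
width `δ` at `win` (`p` reached, `0 ≤ w p`, `0 ≤ φ`) puts the dialled datum `dial p K w` OUTSIDE the
`φ`-floor-nodeless (even ∧ odd) reader at `win` for every `K ≤ 1 − δ`. [folklore] -/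
theorem dial_not_mem_floorNodelessEOAt_of_evenCertificate {win : Window} {p : ℕ} (hp : p ∈ primeRange (2 * win.a))
    {w : Weights} (hw : 0 ≤ w p) {φ : ℝ} (hφ : 0 ≤ φ) {δ : ℝ} (hδ : 0 < δ) {v : Fin (win.N + 1) → ℝ} (hv : v ≠ 0)
    {ℓ σ : ℝ} (hℓ : v ⬝ᵥ (evenBlock w win *ᵥ v) ≤ ℓ * (v ⬝ᵥ v))
    (hσ : autocorr (2 * win.a) v (Real.log p) ≤ -σ * (v ⬝ᵥ v))
    (hcert : ℓ - bottomRayleigh (evenBlock w win) < 2 * δ * w p * (σ - 2 * φ * (2 * win.N + 1)))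
    {K : ℝ} (hK : K ≤ 1 - δ) : datumOf (dial p K w) ∉ floorNodelessEOAt φ win := by
  have hgap : 0 ≤ ℓ - bottomRayleigh (evenBlock w win) := by
    have hvv : 0 < v ⬝ᵥ v :=
      lt_of_le_of_ne (dotProduct_self_nonneg_real v) fun h => hv (dotProduct_self_eq_zero.1 h.symm)
    have h := bottomRayleigh_mul_le_form (evenBlock w win) v
    nlinarith
  have hpos : 0 < w p * (σ - 2 * φ * (2 * win.N + 1)) := by
    by_contra h; push Not at h
    have h2 : δ * (w p * (σ - 2 * φ * (2 * win.N + 1))) ≤ 0 := mul_nonpos_iff.2 (Or.inl ⟨hδ.le, h⟩)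
    nlinarith
  refine dial_not_mem_floorNodelessEOAt_of_threshold hp (by linarith) hw hφ hv hℓ hσ ?_
  calc ℓ - bottomRayleigh (evenBlock w win) < 2 * δ * w p * (σ - 2 * φ * (2 * win.N + 1)) := hcert
    _ = 2 * δ * (w p * (σ - 2 * φ * (2 * win.N + 1))) := by ring
    _ ≤ 2 * (1 - K) * (w p * (σ - 2 * φ * (2 * win.N + 1))) := by nlinarith
    _ = 2 * (1 - K) * w p * (σ - 2 * φ * (2 * win.N + 1)) := by ring

/-- **PROVED — ODD CERTIFICATE ⇒ EVERY UP-DIAL BEYOND ITS WIDTH ESCAPES AT THIS WINDOW.** An odd certificate of width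
`δ` at `win` with one-signed-odd ceiling `c` at lag `log p` puts `dial p K w` OUTSIDE the `φ`-floor-nodeless reader at
`win` for every `K ≥ 1 + δ`. [folklore] -/
theorem dial_not_mem_floorNodelessEOAt_of_oddCertificate {win : Window} {p : ℕ} (hp : p ∈ primeRange (2 * win.a))
    {w : Weights} (hw : 0 ≤ w p) {φ c δ : ℝ} (hδ : 0 < δ)
    (hceil : ∀ u : Fin win.N → ℝ, FloorOneSignedOdd (2 * win.a) φ u → oddAutocorr (2 * win.a) u (Real.log p) ≤ c * (u ⬝ᵥ u))
    {v : Fin win.N → ℝ} (hv : v ≠ 0) {ℓ τ : ℝ} (hℓ : v ⬝ᵥ (oddBlock w win *ᵥ v) ≤ ℓ * (v ⬝ᵥ v))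
    (hτ : τ * (v ⬝ᵥ v) ≤ oddAutocorr (2 * win.a) v (Real.log p))
    (hcert : ℓ - bottomRayleigh (oddBlock w win) < 2 * δ * w p * (τ - c))
    {K : ℝ} (hK : 1 + δ ≤ K) : datumOf (dial p K w) ∉ floorNodelessEOAt φ win := by
  have hgap : 0 ≤ ℓ - bottomRayleigh (oddBlock w win) := by
    have hvv : 0 < v ⬝ᵥ v :=
      lt_of_le_of_ne (dotProduct_self_nonneg_real v) fun h => hv (dotProduct_self_eq_zero.1 h.symm)
    have h := bottomRayleigh_mul_le_form (oddBlock w win) v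
    nlinarith
  have hpos : 0 < w p * (τ - c) := by
    by_contra h; push Not at h
    have h2 : δ * (w p * (τ - c)) ≤ 0 := mul_nonpos_iff.2 (Or.inl ⟨hδ.le, h⟩)
    nlinarith
  have hK1 : 1 ≤ K := by linarith
  intro hmem
  refine upDial_not_mem_floorNodelessOddAt_of_ceiling hp hK1 hw hceil ?_ hmem.2
  refine upDial_levelDrop_of_threshold hp hK1 hw hv hℓ hτ ?_
  calc ℓ - bottomRayleigh (oddBlock w win) < 2 * δ * w p * (τ - c) := hcert
    _ = 2 * δ * (w p * (τ - c)) := by ring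
    _ ≤ 2 * (K - 1) * (w p * (τ - c)) := by nlinarith
    _ = 2 * (K - 1) * w p * (τ - c) := by ring

/-! ## §2 Rigidity along a family of windows carrying vanishing certificates -/

/-- **PROVED — LOWER RIGIDITY.** If the family `𝒲` carries even certificates of every width `δ > 0` (for `ζ`: a
DATA question per window, OPEN along `a → ∞`), then every `K` whose dialled datum is `φ`-floor-nodeless at every
window of `𝒲` satisfies `1 ≤ K`: no down-dial survives the family. [folklore] -/
theorem one_le_of_evenCertificates {p : ℕ} {w : Weights} (hw : 0 ≤ w p) {φ : ℝ} (hφ : 0 ≤ φ) {𝒲 : Set Window}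
    (heven : ∀ δ : ℝ, 0 < δ → ∃ win ∈ 𝒲, p ∈ primeRange (2 * win.a) ∧ ∃ v : Fin (win.N + 1) → ℝ, v ≠ 0 ∧
      ∃ ℓ σ : ℝ, v ⬝ᵥ (evenBlock w win *ᵥ v) ≤ ℓ * (v ⬝ᵥ v) ∧ autocorr (2 * win.a) v (Real.log p) ≤ -σ * (v ⬝ᵥ v) ∧
        ℓ - bottomRayleigh (evenBlock w win) < 2 * δ * w p * (σ - 2 * φ * (2 * win.N + 1)))
    {K : ℝ} (hK : ∀ win ∈ 𝒲, datumOf (dial p K w) ∈ floorNodelessEOAt φ win) : 1 ≤ K := by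
  by_contra h
  push Not at h
  obtain ⟨win, hwin, hp, v, hv, ℓ, σ, hℓ, hσ, hcert⟩ := heven (1 - K) (by linarith)
  exact dial_not_mem_floorNodelessEOAt_of_evenCertificate hp hw hφ (by linarith) hv hℓ hσ hcert (by linarith)
    (hK win hwin)

/-- **PROVED — UPPER RIGIDITY.** If `𝒲` carries odd certificates (each with a one-signed-odd ceiling at lag `log p`)
of every width, then every `K` whose dialled datum is `φ`-floor-nodeless along `𝒲` satisfies `K ≤ 1`. [folklore] -/
theorem le_one_of_oddCertificates {p : ℕ} {w : Weights} (hw : 0 ≤ w p) {φ : ℝ} {𝒲 : Set Window}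
    (hodd : ∀ δ : ℝ, 0 < δ → ∃ win ∈ 𝒲, p ∈ primeRange (2 * win.a) ∧ ∃ c : ℝ,
      (∀ u : Fin win.N → ℝ, FloorOneSignedOdd (2 * win.a) φ u → oddAutocorr (2 * win.a) u (Real.log p) ≤ c * (u ⬝ᵥ u)) ∧
      ∃ v : Fin win.N → ℝ, v ≠ 0 ∧ ∃ ℓ τ : ℝ, v ⬝ᵥ (oddBlock w win *ᵥ v) ≤ ℓ * (v ⬝ᵥ v) ∧
        τ * (v ⬝ᵥ v) ≤ oddAutocorr (2 * win.a) v (Real.log p) ∧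
        ℓ - bottomRayleigh (oddBlock w win) < 2 * δ * w p * (τ - c))
    {K : ℝ} (hK : ∀ win ∈ 𝒲, datumOf (dial p K w) ∈ floorNodelessEOAt φ win) : K ≤ 1 := by
  by_contra h
  push Not at h
  obtain ⟨win, hwin, hp, c, hceil, v, hv, ℓ, τ, hℓ, hτ, hcert⟩ := hodd (K - 1) (by linarith)
  exact dial_not_mem_floorNodelessEOAt_of_oddCertificate hp hw (by linarith) hceil hv hℓ hτ hcert (by linarith)
    (hK win hwin)

/-- **PROVED — DIAL-LINE RIGIDITY.** Even AND odd certificates of every width along `𝒲` ⇒ the only dial whose datum is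
`φ`-floor-nodeless (even ∧ odd bottom states) at every window of `𝒲` is `K = 1`, i.e. the undialled datum itself.
RH-free and weight-free; for `ζ` the premisses are DATA/OPEN (header) and nothing here asserts them. [folklore] -/
theorem dial_eq_one_of_certificates {p : ℕ} {w : Weights} (hw : 0 ≤ w p) {φ : ℝ} (hφ : 0 ≤ φ) {𝒲 : Set Window}
    (heven : ∀ δ : ℝ, 0 < δ → ∃ win ∈ 𝒲, p ∈ primeRange (2 * win.a) ∧ ∃ v : Fin (win.N + 1) → ℝ, v ≠ 0 ∧
      ∃ ℓ σ : ℝ, v ⬝ᵥ (evenBlock w win *ᵥ v) ≤ ℓ * (v ⬝ᵥ v) ∧ autocorr (2 * win.a) v (Real.log p) ≤ -σ * (v ⬝ᵥ v) ∧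
        ℓ - bottomRayleigh (evenBlock w win) < 2 * δ * w p * (σ - 2 * φ * (2 * win.N + 1)))
    (hodd : ∀ δ : ℝ, 0 < δ → ∃ win ∈ 𝒲, p ∈ primeRange (2 * win.a) ∧ ∃ c : ℝ,
      (∀ u : Fin win.N → ℝ, FloorOneSignedOdd (2 * win.a) φ u → oddAutocorr (2 * win.a) u (Real.log p) ≤ c * (u ⬝ᵥ u)) ∧
      ∃ v : Fin win.N → ℝ, v ≠ 0 ∧ ∃ ℓ τ : ℝ, v ⬝ᵥ (oddBlock w win *ᵥ v) ≤ ℓ * (v ⬝ᵥ v) ∧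
        τ * (v ⬝ᵥ v) ≤ oddAutocorr (2 * win.a) v (Real.log p) ∧
        ℓ - bottomRayleigh (oddBlock w win) < 2 * δ * w p * (τ - c))
    {K : ℝ} (hK : ∀ win ∈ 𝒲, datumOf (dial p K w) ∈ floorNodelessEOAt φ win) : K = 1 :=
  le_antisymm (le_one_of_oddCertificates hw hodd hK) (one_le_of_evenCertificates hw hφ heven hK)

/-- **PROVED — the same, as a statement about the dial LINE:** the set of dials whose datum is `φ`-floor-nodeless along
`𝒲` is contained in `{1}`. [folklore] -/
theorem dialLine_subset_singleton_of_certificates {p : ℕ} {w : Weights} (hw : 0 ≤ w p) {φ : ℝ} (hφ : 0 ≤ φ)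
    {𝒲 : Set Window}
    (heven : ∀ δ : ℝ, 0 < δ → ∃ win ∈ 𝒲, p ∈ primeRange (2 * win.a) ∧ ∃ v : Fin (win.N + 1) → ℝ, v ≠ 0 ∧
      ∃ ℓ σ : ℝ, v ⬝ᵥ (evenBlock w win *ᵥ v) ≤ ℓ * (v ⬝ᵥ v) ∧ autocorr (2 * win.a) v (Real.log p) ≤ -σ * (v ⬝ᵥ v) ∧
        ℓ - bottomRayleigh (evenBlock w win) < 2 * δ * w p * (σ - 2 * φ * (2 * win.N + 1)))
    (hodd : ∀ δ : ℝ, 0 < δ → ∃ win ∈ 𝒲, p ∈ primeRange (2 * win.a) ∧ ∃ c : ℝ,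
      (∀ u : Fin win.N → ℝ, FloorOneSignedOdd (2 * win.a) φ u → oddAutocorr (2 * win.a) u (Real.log p) ≤ c * (u ⬝ᵥ u)) ∧
      ∃ v : Fin win.N → ℝ, v ≠ 0 ∧ ∃ ℓ τ : ℝ, v ⬝ᵥ (oddBlock w win *ᵥ v) ≤ ℓ * (v ⬝ᵥ v) ∧
        τ * (v ⬝ᵥ v) ≤ oddAutocorr (2 * win.a) v (Real.log p) ∧
        ℓ - bottomRayleigh (oddBlock w win) < 2 * δ * w p * (τ - c)) :
    {K : ℝ | ∀ win ∈ 𝒲, datumOf (dial p K w) ∈ floorNodelessEOAt φ win} ⊆ {1} :=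
  fun _ hK => dial_eq_one_of_certificates hw hφ heven hodd hK

/-! ## §3 The all-window class and the `pDial` line of G1 -/

/-- **PROVED — RIGIDITY OF THE ALL-WINDOW CLASS `⋂ win, floorNodelessEOAt φ win` ALONG THE `p`-DIAL** (any weights with
`0 ≤ w p`; certificates anywhere). [folklore] -/
theorem dial_mem_iInter_floorNodelessEOAt_imp_eq_one {p : ℕ} {w : Weights} (hw : 0 ≤ w p) {φ : ℝ} (hφ : 0 ≤ φ)
    (heven : ∀ δ : ℝ, 0 < δ → ∃ win : Window, p ∈ primeRange (2 * win.a) ∧ ∃ v : Fin (win.N + 1) → ℝ, v ≠ 0 ∧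
      ∃ ℓ σ : ℝ, v ⬝ᵥ (evenBlock w win *ᵥ v) ≤ ℓ * (v ⬝ᵥ v) ∧ autocorr (2 * win.a) v (Real.log p) ≤ -σ * (v ⬝ᵥ v) ∧
        ℓ - bottomRayleigh (evenBlock w win) < 2 * δ * w p * (σ - 2 * φ * (2 * win.N + 1)))
    (hodd : ∀ δ : ℝ, 0 < δ → ∃ win : Window, p ∈ primeRange (2 * win.a) ∧ ∃ c : ℝ,
      (∀ u : Fin win.N → ℝ, FloorOneSignedOdd (2 * win.a) φ u → oddAutocorr (2 * win.a) u (Real.log p) ≤ c * (u ⬝ᵥ u)) ∧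
      ∃ v : Fin win.N → ℝ, v ≠ 0 ∧ ∃ ℓ τ : ℝ, v ⬝ᵥ (oddBlock w win *ᵥ v) ≤ ℓ * (v ⬝ᵥ v) ∧
        τ * (v ⬝ᵥ v) ≤ oddAutocorr (2 * win.a) v (Real.log p) ∧
        ℓ - bottomRayleigh (oddBlock w win) < 2 * δ * w p * (τ - c))
    {K : ℝ} (hK : datumOf (dial p K w) ∈ ⋂ win, floorNodelessEOAt φ win) : K = 1 := by
  refine dial_eq_one_of_certificates (𝒲 := Set.univ) hw hφ ?_ ?_ (fun win _ => Set.mem_iInter.1 hK win)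
  · intro δ hδ; obtain ⟨win, h⟩ := heven δ hδ; exact ⟨win, Set.mem_univ _, h⟩
  · intro δ hδ; obtain ⟨win, h⟩ := hodd δ hδ; exact ⟨win, Set.mem_univ _, h⟩

/-- **PROVED — `ζ` HANDLE: RIGIDITY OF THE `pDial` LINE OF G1** (`pDial p K = datumOf (dial p K zetaWeights)`): under
vanishing even and odd certificates for `ζ` at the prime power `p` (OPEN; DATA-false along fixed-`a` families, header)
the `pDial p` line meets the all-window `φ`-floor-nodeless class only at `K = 1`.  This constrains MEMBERSHIP of the
dialled data; it says nothing about clause (3) `StableAlong` of G1 (agreement with some member per window) and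
nothing about RH. [folklore] -/
theorem pDial_mem_iInter_floorNodelessEOAt_imp_eq_one {p : ℕ} {φ : ℝ} (hφ : 0 ≤ φ)
    (heven : ∀ δ : ℝ, 0 < δ → ∃ win : Window, p ∈ primeRange (2 * win.a) ∧ ∃ v : Fin (win.N + 1) → ℝ, v ≠ 0 ∧
      ∃ ℓ σ : ℝ, v ⬝ᵥ (evenBlock zetaWeights win *ᵥ v) ≤ ℓ * (v ⬝ᵥ v) ∧
        autocorr (2 * win.a) v (Real.log p) ≤ -σ * (v ⬝ᵥ v) ∧
        ℓ - bottomRayleigh (evenBlock zetaWeights win) < 2 * δ * zetaWeights p * (σ - 2 * φ * (2 * win.N + 1)))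
    (hodd : ∀ δ : ℝ, 0 < δ → ∃ win : Window, p ∈ primeRange (2 * win.a) ∧ ∃ c : ℝ,
      (∀ u : Fin win.N → ℝ, FloorOneSignedOdd (2 * win.a) φ u → oddAutocorr (2 * win.a) u (Real.log p) ≤ c * (u ⬝ᵥ u)) ∧
      ∃ v : Fin win.N → ℝ, v ≠ 0 ∧ ∃ ℓ τ : ℝ, v ⬝ᵥ (oddBlock zetaWeights win *ᵥ v) ≤ ℓ * (v ⬝ᵥ v) ∧
        τ * (v ⬝ᵥ v) ≤ oddAutocorr (2 * win.a) v (Real.log p) ∧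
        ℓ - bottomRayleigh (oddBlock zetaWeights win) < 2 * δ * zetaWeights p * (τ - c)) :
    {K : ℝ | pDial p K ∈ ⋂ win, floorNodelessEOAt φ win} ⊆ {1} :=
  fun _ hK => dial_mem_iInter_floorNodelessEOAt_imp_eq_one (zetaWeights_nonneg p) hφ heven hodd hK

/-! ## §4 The rung-free instance: odd certificates against the complete near-lag ladder -/

/-- **PROVED — UPPER RIGIDITY, RUNG-FREE** (`0 < log p`; the odd ceiling at each window is the ladder's
`cos(π/(⌈a/log p⌉₊+1)) + 2φN` of `PfPersistenceNearLagLadder`, so a certificate is just `(v', ℓ', τ)` with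
`ℓ' − ε₁⁻ < 2δ·w_p·(τ − cos(π/(⌈a/log p⌉₊+1)) − 2φN)`): odd certificates of every width along `𝒲` ⇒ `K ≤ 1` for every
dial `φ`-floor-nodeless along `𝒲`.  This is the form that lives in the un-served regime `a → ∞` at the fixed prime
(`⌈a/log p⌉₊ → ∞`). [folklore] -/
theorem le_one_of_oddCertificates_ceil {p : ℕ} (hlog : 0 < Real.log p) {w : Weights} (hw : 0 ≤ w p) {φ : ℝ}
    (hφ : 0 ≤ φ) {𝒲 : Set Window}
    (hodd : ∀ δ : ℝ, 0 < δ → ∃ win ∈ 𝒲, p ∈ primeRange (2 * win.a) ∧ ∃ v : Fin win.N → ℝ, v ≠ 0 ∧ ∃ ℓ τ : ℝ,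
      v ⬝ᵥ (oddBlock w win *ᵥ v) ≤ ℓ * (v ⬝ᵥ v) ∧ τ * (v ⬝ᵥ v) ≤ oddAutocorr (2 * win.a) v (Real.log p) ∧
        ℓ - bottomRayleigh (oddBlock w win)
          < 2 * δ * w p * (τ - Real.cos (π / ((⌈win.a / Real.log p⌉₊ : ℕ) + 1)) - 2 * φ * win.N))
    {K : ℝ} (hK : ∀ win ∈ 𝒲, datumOf (dial p K w) ∈ floorNodelessEOAt φ win) : K ≤ 1 := by
  refine le_one_of_oddCertificates hw (fun δ hδ => ?_) hK
  obtain ⟨win, hwin, hp, v, hv, ℓ, τ, hℓ, hτ, hcert⟩ := hodd δ hδ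
  have hL : 0 < 2 * win.a := by linarith [win.ha]
  have hy : 2 * win.a / (2 * ((⌈win.a / Real.log p⌉₊ : ℕ) : ℝ)) ≤ Real.log p := by
    rw [mul_div_mul_left _ _ (two_ne_zero)]; exact (rung_ceil hlog).2
  refine ⟨win, hwin, hp, Real.cos (π / ((⌈win.a / Real.log p⌉₊ : ℕ) + 1)) + 2 * φ * win.N,
    fun u hu => oddAutocorr_le_of_floorOneSignedOdd_rung hL hφ hu (rung_ceil hlog).1 hy
      (log_le_of_mem_primeRange hL.le hp), v, hv, ℓ, τ, hℓ, hτ, ?_⟩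
  have e : τ - (Real.cos (π / ((⌈win.a / Real.log p⌉₊ : ℕ) + 1)) + 2 * φ * win.N)
      = τ - Real.cos (π / ((⌈win.a / Real.log p⌉₊ : ℕ) + 1)) - 2 * φ * win.N := by ring
  rw [e]; exact hcert

/-- **PROVED — DIAL-LINE RIGIDITY, RUNG-FREE** (even certificates as in §2, odd ones against the ladder). [folklore] -/
theorem dial_eq_one_of_certificates_ceil {p : ℕ} (hlog : 0 < Real.log p) {w : Weights} (hw : 0 ≤ w p) {φ : ℝ}
    (hφ : 0 ≤ φ) {𝒲 : Set Window}
    (heven : ∀ δ : ℝ, 0 < δ → ∃ win ∈ 𝒲, p ∈ primeRange (2 * win.a) ∧ ∃ v : Fin (win.N + 1) → ℝ, v ≠ 0 ∧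
      ∃ ℓ σ : ℝ, v ⬝ᵥ (evenBlock w win *ᵥ v) ≤ ℓ * (v ⬝ᵥ v) ∧ autocorr (2 * win.a) v (Real.log p) ≤ -σ * (v ⬝ᵥ v) ∧
        ℓ - bottomRayleigh (evenBlock w win) < 2 * δ * w p * (σ - 2 * φ * (2 * win.N + 1)))
    (hodd : ∀ δ : ℝ, 0 < δ → ∃ win ∈ 𝒲, p ∈ primeRange (2 * win.a) ∧ ∃ v : Fin win.N → ℝ, v ≠ 0 ∧ ∃ ℓ τ : ℝ,
      v ⬝ᵥ (oddBlock w win *ᵥ v) ≤ ℓ * (v ⬝ᵥ v) ∧ τ * (v ⬝ᵥ v) ≤ oddAutocorr (2 * win.a) v (Real.log p) ∧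
        ℓ - bottomRayleigh (oddBlock w win)
          < 2 * δ * w p * (τ - Real.cos (π / ((⌈win.a / Real.log p⌉₊ : ℕ) + 1)) - 2 * φ * win.N))
    {K : ℝ} (hK : ∀ win ∈ 𝒲, datumOf (dial p K w) ∈ floorNodelessEOAt φ win) : K = 1 :=
  le_antisymm (le_one_of_oddCertificates_ceil hlog hw hφ hodd hK) (one_le_of_evenCertificates hw hφ heven hK)

/-- **PROVED — `ζ` HANDLE, RUNG-FREE** (`0 < zetaWeights p` forces `2 ≤ p`; every premiss about `ζ` at a window is
DATA wherever asserted, and the vanishing along `𝒲` is OPEN — DATA-false along fixed-`a` families, header): the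
`pDial p` line meets `{d | ∀ win ∈ 𝒲, d ∈ floorNodelessEOAt φ win}` only at `K = 1`.  No statement about RH. [folklore] -/
theorem pDial_eq_one_of_certificates_ceil {p : ℕ} (hp0 : 0 < zetaWeights p) {φ : ℝ} (hφ : 0 ≤ φ) {𝒲 : Set Window}
    (heven : ∀ δ : ℝ, 0 < δ → ∃ win ∈ 𝒲, p ∈ primeRange (2 * win.a) ∧ ∃ v : Fin (win.N + 1) → ℝ, v ≠ 0 ∧
      ∃ ℓ σ : ℝ, v ⬝ᵥ (evenBlock zetaWeights win *ᵥ v) ≤ ℓ * (v ⬝ᵥ v) ∧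
        autocorr (2 * win.a) v (Real.log p) ≤ -σ * (v ⬝ᵥ v) ∧
        ℓ - bottomRayleigh (evenBlock zetaWeights win) < 2 * δ * zetaWeights p * (σ - 2 * φ * (2 * win.N + 1)))
    (hodd : ∀ δ : ℝ, 0 < δ → ∃ win ∈ 𝒲, p ∈ primeRange (2 * win.a) ∧ ∃ v : Fin win.N → ℝ, v ≠ 0 ∧ ∃ ℓ τ : ℝ,
      v ⬝ᵥ (oddBlock zetaWeights win *ᵥ v) ≤ ℓ * (v ⬝ᵥ v) ∧ τ * (v ⬝ᵥ v) ≤ oddAutocorr (2 * win.a) v (Real.log p) ∧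
        ℓ - bottomRayleigh (oddBlock zetaWeights win)
          < 2 * δ * zetaWeights p * (τ - Real.cos (π / ((⌈win.a / Real.log p⌉₊ : ℕ) + 1)) - 2 * φ * win.N))
    {K : ℝ} (hK : ∀ win ∈ 𝒲, pDial p K ∈ floorNodelessEOAt φ win) : K = 1 :=
  have h2 : (2:ℝ) ≤ p := by exact_mod_cast two_le_of_zetaWeights_pos hp0
  dial_eq_one_of_certificates_ceil (Real.log_pos (by linarith)) (zetaWeights_nonneg p) hφ heven hodd hK

end Summit.RiemannHypothesis.RiemannHypothesis.Theorems.PfPersistence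

end
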